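import Summits.AtomisticToContinuum.HydrodynamicLimit.Theorems.BoxDissipativeWeakStrongEntropyAdmissibilityStubConcentrationOfPTBC
import Summits.AtomisticToContinuum.HydrodynamicLimit.Theorems.JParityClosureOddContactSymmetryGibbsInvariance

/-!
# Crux `EntropyAdmissibility` (stmt-AtomisticToContinuum-9903), line `registered` — helpers for the stub
# `stub_globalEquilibriumEntropyBalance` (GE3: the global-equilibrium entropy balance)

Toolbox (file A of two) for the registered stub GE3 `stub_globalEquilibriumEntropyBalance` of the line `registered`
of the crux `Summit.AtomisticToContinuum.HydrodynamicLimit.Theses.BoxDissipativeWeakStrong.EntropyAdmissibility`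
(at GLOBAL equilibrium the dynamic part `A_N` of the clamp-renormalised entropy balance converges in `L¹(P_N)` to
minus the initial entropy `−B`); anchored to the crux item by the registered helper stub
`stub_globalEquilibriumEntropyBalanceA` (a conjunction of two of the facts below). Contents (pure measure theory, and
statics of the box fields):

* `tendsto_lintegral_integral_sub` — `L¹(P_N)`-convergence to an EXPLICIT deterministic limit passes to time
  integrals: if `g_N(t, ·) → m(t)` in `L¹(P_N)` for `ν`-a.e. `t`, `g_N` is jointly measurable with an affine bound
  `|g_N(t, z)| ≤ C + D W_N(z)`, `sup_N E W_N ≤ K`, and `m` is bounded measurable, then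
  `∫ g_N(t, ·) dν(t) → ∫ m dν` in `L¹(P_N)` (Tonelli and dominated convergence in `t`; the twin of
  `EABirthS2bA.tendsto_conc_integral`, "concentration about the mean" replaced by "convergence to the limit");
* `lintegral_abs_sub_gflow_eq` — along a law carried by the good set and INVARIANT under `Φ_t`, the `L¹` distance of
  a measurable static functional `F` to a constant is the same at flow-time `t` (regularised flow `EABirthS2b.gflow`)
  as at flow-time `0` (`lintegral_map`, `Φ_0 = id` on the good set);
* statics of `EABirthS1a.statBulk`: its space integral splits as `∫ ρ̂ Z ψ₁ dx + ∫ Z m̂·ψ₂ dx` (both integrable in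
  `x`) and obeys the `N`-UNIFORM affine bound `|∫ statBulk dx| ≤ M‖ψ₁‖_∞ + M‖ψ₂‖_∞ (½ + ½ (N+1)⁻¹Σ‖vᵢ‖²)`
  (`∫ ρ̂ dx = 1`, `∫ ‖m̂‖ dx ≤ (N+1)⁻¹Σ‖vᵢ‖`, `EABirthS2bA`);
* for CONSTANT profiles (`map_flow_localGibbsLaw_const`: the global Gibbs law is invariant under every hard-sphere
  flow) the static laws of large numbers at flow-time `0` for the two entropy functionals (the conclusion of GE1)
  transfer to every flow-time `t`: `tendsto_bulk`, `tendsto_bdry`.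

References: H. Spohn, *Large Scale Dynamics of Interacting Particles* (1991), Part I §2.3, Ch. 3; J. Březina,
E. Feireisl, J. Math. Soc. Japan 70 (2018), Def. 2.9, §3.2. prover-line-stmt-AtomisticToContinuum-9903-c2-0 (worker GE3).
-/

noncomputable section

open MeasureTheory Filter Set
open scoped ENNReal Topology

namespace Summit.AtomisticToContinuum.HydrodynamicLimit.Theorems.EABirthGE3

open Literature.MathematicalPhysics.KineticTheory
open Literature.Analysis.FluidPDE.CompressibleEuler (clamp)
open Summit.AtomisticToContinuum.HydrodynamicLimit.Theses
open Summit.AtomisticToContinuum.HydrodynamicLimit.Theorems.BDWS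
open Literature.Analysis.FluidPDE (Config HardSphereFlow)
open Literature.Analysis.FunctionSpaces
open EABirthS1a (statEntropy statBulk statBdry)
open EABirthS2bA (integrable_of_abs_le_affine integrable_of_lintegral_ofReal_le)
open EABirthS2b (gflow gflow_ae_eq)

/-! ## `L¹` convergence of time integrals to an explicit limit -/

section Conc

variable {Ω : ℕ → Type*} [∀ N, MeasurableSpace (Ω N)] (P : ∀ N, Measure (Ω N))

/-- **`L¹` convergence of time integrals to an explicit limit.** On probability spaces `(Ω_N, P_N)` and a finite
measure space `(γ, ν)`: if `g_N : γ × Ω_N → ℝ` is jointly measurable with `|g_N(t, z)| ≤ C + D W_N(z)`, `W_N ≥ 0`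
measurable with `E_{P_N} W_N ≤ K` uniformly, `m : γ → ℝ` is measurable with `|m| ≤ Cm`, and
`E_{P_N}|g_N(t, ·) − m(t)| → 0` for `ν`-a.e. `t`, then `z ↦ ∫ g_N(t, z) dν(t)` is `P_N`-integrable and
`E_{P_N}|∫ g_N(t, ·) dν(t) − ∫ m dν| → 0`. -/
theorem tendsto_lintegral_integral_sub (hP : ∀ N, IsProbabilityMeasure (P N)) {γ : Type*} [MeasurableSpace γ]
    (ν : Measure γ) [IsFiniteMeasure ν] {g : ∀ N, γ → Ω N → ℝ} {W : ∀ N, Ω N → ℝ} {m : γ → ℝ} {C D K Cm : ℝ}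
    (hg : ∀ N, Measurable fun p : γ × Ω N => g N p.1 p.2) (hW : ∀ N, Measurable (W N))
    (hW0 : ∀ N z, 0 ≤ W N z) (hWK : ∀ N, ∫⁻ z, ENNReal.ofReal (W N z) ∂P N ≤ ENNReal.ofReal K)
    (hC : 0 ≤ C) (hD : 0 ≤ D) (hK : 0 ≤ K) (hbd : ∀ N t z, |g N t z| ≤ C + D * W N z)
    (hm : Measurable m) (hmb : ∀ t, |m t| ≤ Cm)
    (hconv : ∀ᵐ t ∂ν, Tendsto (fun N => ∫⁻ z, ENNReal.ofReal |g N t z - m t| ∂P N) atTop (𝓝 0)) :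
    (∀ N, Integrable (fun z => ∫ t, g N t z ∂ν) (P N)) ∧
      Tendsto (fun N => ∫⁻ z, ENNReal.ofReal |(∫ t, g N t z ∂ν) - ∫ t, m t ∂ν| ∂P N) atTop (𝓝 0) := by
  haveI := hP
  have hWi : ∀ N, Integrable (W N) (P N) ∧ ∫ z, W N z ∂P N ≤ K := fun N =>
    integrable_of_lintegral_ofReal_le (hW N) (hW0 N) hK (hWK N)
  have hgt : ∀ N z, Integrable (fun t => g N t z) ν := fun N z =>
    integrable_of_abs_le_affine (W := fun _ => W N z) (D := D)
      ((hg N).comp (measurable_id.prodMk measurable_const)).aestronglyMeasurable (integrable_const _)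
      (fun t => hbd N t z)
  have hmi : Integrable m ν :=
    integrable_of_abs_le_affine (W := fun _ => (0 : ℝ)) (C := Cm) (D := 0) hm.aestronglyMeasurable
      (integrable_const _) (fun t => by rw [zero_mul, add_zero]; exact hmb t)
  -- the `L¹` distance at fixed `t` is measurable in `t` and uniformly bounded
  have hFm : ∀ N, Measurable fun p : γ × Ω N => ENNReal.ofReal |g N p.1 p.2 - m p.1| := fun N =>
    (continuous_abs.measurable.comp ((hg N).sub (hm.comp measurable_fst))).ennreal_ofReal
  set B : ℝ≥0∞ := ENNReal.ofReal C + ENNReal.ofReal D * ENNReal.ofReal K + ENNReal.ofReal Cm with hB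
  have hBtop : B ≠ ⊤ := ENNReal.add_ne_top.2 ⟨ENNReal.add_ne_top.2 ⟨ENNReal.ofReal_ne_top,
    ENNReal.mul_ne_top ENNReal.ofReal_ne_top ENNReal.ofReal_ne_top⟩, ENNReal.ofReal_ne_top⟩
  have hF_bd : ∀ N t, (∫⁻ z, ENNReal.ofReal |g N t z - m t| ∂P N) ≤ B := fun N t => by
    calc ∫⁻ z, ENNReal.ofReal |g N t z - m t| ∂P N
        ≤ ∫⁻ z, (ENNReal.ofReal C + ENNReal.ofReal D * ENNReal.ofReal (W N z) + ENNReal.ofReal Cm) ∂P N :=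
          lintegral_mono fun z => by
            have h1 : |g N t z - m t| ≤ (C + D * W N z) + |m t| :=
              (abs_sub _ _).trans (add_le_add (hbd N t z) le_rfl)
            calc ENNReal.ofReal |g N t z - m t| ≤ ENNReal.ofReal ((C + D * W N z) + |m t|) :=
                  ENNReal.ofReal_le_ofReal h1
              _ = ENNReal.ofReal C + ENNReal.ofReal D * ENNReal.ofReal (W N z) + ENNReal.ofReal |m t| := by
                  rw [ENNReal.ofReal_add (add_nonneg hC (mul_nonneg hD (hW0 N z))) (abs_nonneg _),
                    ENNReal.ofReal_add hC (mul_nonneg hD (hW0 N z)), ENNReal.ofReal_mul hD]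
              _ ≤ _ := add_le_add le_rfl (ENNReal.ofReal_le_ofReal (hmb t))
      _ = ENNReal.ofReal C + ENNReal.ofReal D * (∫⁻ z, ENNReal.ofReal (W N z) ∂P N) + ENNReal.ofReal Cm := by
          rw [lintegral_add_right _ measurable_const, lintegral_add_left measurable_const, lintegral_const,
            lintegral_const, measure_univ, mul_one, mul_one, lintegral_const_mul' _ _ ENNReal.ofReal_ne_top]
      _ ≤ B := by rw [hB]; gcongr; exact hWK N
  -- dominated convergence in `t`
  have hDCT : Tendsto (fun N => ∫⁻ t, (∫⁻ z, ENNReal.ofReal |g N t z - m t| ∂P N) ∂ν) atTop (𝓝 0) := by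
    have h := tendsto_lintegral_of_dominated_convergence (μ := ν) (fun _ => B)
      (fun N => (hFm N).lintegral_prod_right') (fun N => Eventually.of_forall (hF_bd N))
      (by rw [lintegral_const]; exact ENNReal.mul_ne_top hBtop (measure_ne_top _ _)) hconv
    simpa only [lintegral_zero] using h
  -- integrability of the time integral
  have hint : ∀ N, Integrable (fun z => ∫ t, g N t z ∂ν) (P N) := fun N =>
    integrable_of_abs_le_affine (C := C * ν.real univ) (D := D * ν.real univ)
      ((hg N).comp measurable_swap).stronglyMeasurable.integral_prod_right'.aestronglyMeasurable (hWi N).1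
      fun z => by
        have h := norm_integral_le_of_norm_le_const (μ := ν) (C := C + D * W N z) (f := fun t => g N t z)
          (Eventually.of_forall fun t => by rw [Real.norm_eq_abs]; exact hbd N t z)
        rw [Real.norm_eq_abs] at h
        nlinarith [h]
  refine ⟨hint, ?_⟩
  refine tendsto_of_tendsto_of_tendsto_of_le_of_le' tendsto_const_nhds hDCT
    (Eventually.of_forall fun N => bot_le) (Eventually.of_forall fun N => ?_)
  calc (∫⁻ z, ENNReal.ofReal |(∫ t, g N t z ∂ν) - ∫ t, m t ∂ν| ∂P N)
      ≤ ∫⁻ z, ∫⁻ t, ENNReal.ofReal |g N t z - m t| ∂ν ∂P N := lintegral_mono fun z => by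
        rw [← integral_sub (hgt N z) hmi, ← Real.enorm_eq_ofReal_abs]
        refine (enorm_integral_le_lintegral_enorm _).trans (le_of_eq (lintegral_congr fun t => ?_))
        rw [Real.enorm_eq_ofReal_abs]
    _ = ∫⁻ t, (∫⁻ z, ENNReal.ofReal |g N t z - m t| ∂P N) ∂ν :=
        lintegral_lintegral_swap ((hFm N).comp measurable_swap).aemeasurable

end Conc

/-! ## Invariant flows: the `L¹` distance of a static functional to a constant is time independent -/

section Transfer

variable {n : ℕ} {ε : ℝ}

/-- **Transfer along an invariant flow.** If the law `μ` is carried by the good set of the hard-sphere flow `Φ`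
and is invariant under `Φ_t`, then for every measurable static functional `F` and constant `c` the `L¹(μ)`
distance of `F ∘ Ψ_t` to `c` (`Ψ = gflow Φ` the regularised flow, `= Φ_t` a.s.) equals that of `F ∘ Φ_0`
(`Φ_0 = id` a.s.; change of variables `lintegral_map`). -/
theorem lintegral_abs_sub_gflow_eq (Φ : HardSphereFlow (Literature.Analysis.FluidPDE.Torus.geometry (Fin 3)) ε n)
    {μ : Measure (Config n (Fin 3) T3)} (hgood : μ Φ.goodᶜ = 0) {t : ℝ} (hinv : μ.map (Φ.flow t) = μ)
    {F : Config n (Fin 3) T3 → ℝ} (hF : Measurable F) (c : ℝ) :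
    ∫⁻ z, ENNReal.ofReal |F (gflow Φ t z) - c| ∂μ = ∫⁻ z, ENNReal.ofReal |F (Φ.flow 0 z) - c| ∂μ := by
  have hm : Measurable fun w => ENNReal.ofReal |F w - c| :=
    (continuous_abs.measurable.comp (hF.sub measurable_const)).ennreal_ofReal
  have hz : ∀ᵐ z ∂μ, z ∈ Φ.good := by rw [ae_iff]; exact hgood
  calc ∫⁻ z, ENNReal.ofReal |F (gflow Φ t z) - c| ∂μ = ∫⁻ z, ENNReal.ofReal |F (Φ.flow t z) - c| ∂μ :=
        lintegral_congr_ae ((gflow_ae_eq Φ hgood).mono fun z hz => by simp only [hz t])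
    _ = ∫⁻ w, ENNReal.ofReal |F w - c| ∂(μ.map (Φ.flow t)) := (lintegral_map hm (Φ.measurable_flow t)).symm
    _ = ∫⁻ z, ENNReal.ofReal |F z - c| ∂μ := by rw [hinv]
    _ = ∫⁻ z, ENNReal.ofReal |F (Φ.flow 0 z) - c| ∂μ :=
        lintegral_congr_ae (hz.mono fun z hz => by simp only [Φ.flow_zero z hz])

end Transfer

/-! ## Statics of the bulk integrand -/

section Statics

variable {N : ℕ} {η₀ σ η₁ a b : ℝ}

/-- `x ↦ ρ̂ Z χ` (`statBdry`) is integrable in the centre `x` for a continuous test slice `χ` (bounded measurable). -/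
theorem integrable_statBdry (hcont : ContinuousOn hsExcessFreeEnergy (Ico 0 η₀)) (hσ : 0 ≤ σ) (hη₁ : 0 ≤ η₁)
    (hη₁c : η₁ < η₀) (hab : a ≤ b) {l : ℝ} (hl : 0 < l) {χ : T3 → ℝ} (hχ : Continuous χ)
    (w : Config (N + 1) (Fin 3) T3) : Integrable fun x => statBdry σ η₁ l a b χ w x := by
  obtain ⟨C, -, hC⟩ := exists_forall_abs_le_of_continuous hχ
  have hm : Measurable (statBdry σ η₁ l a b χ w) :=
    (EABirthS1a.measurable_statBdry (EABirthS1a.measurable_statEntropy hcont hσ hη₁ hη₁c hl.le a b)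
      hχ.measurable).of_uncurry_left
  refine (integrable_const ((l ^ 3)⁻¹ * max |a| |b| * C)).mono' hm.aestronglyMeasurable
    (Eventually.of_forall fun x => ?_)
  rw [Real.norm_eq_abs]
  exact EABirthS1a.abs_statBdry_le hab hl.le ((Real.norm_eq_abs _).trans_le (hC x)) w

/-- `x ↦ Z m̂·Ψ` is integrable in the centre `x` for a continuous vector test slice `Ψ` (`|Z| ≤ |a| ∨ |b|`, `m̂`
integrable in `x`). -/
theorem integrable_statEntropy_mul_inner (hcont : ContinuousOn hsExcessFreeEnergy (Ico 0 η₀)) (hσ : 0 ≤ σ)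
    (hη₁ : 0 ≤ η₁) (hη₁c : η₁ < η₀) (hab : a ≤ b) {l : ℝ} (hl : 0 < l) {Ψ : T3 → V3} (hΨ : Continuous Ψ)
    (w : Config (N + 1) (Fin 3) T3) :
    Integrable fun x => statEntropy σ η₁ l a b w x * inner ℝ (empiricalMomentumField w (boxKernel l x)) (Ψ x) := by
  obtain ⟨G, -, hG⟩ := exists_forall_abs_le_of_continuous hΨ.norm
  have hZ : Measurable (statEntropy σ η₁ l a b w) :=
    (EABirthS1a.measurable_statEntropy (N := N) hcont hσ hη₁ hη₁c hl.le a b).of_uncurry_left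
  have hM : Measurable fun x => empiricalMomentumField w (boxKernel l x) :=
    Measurable.of_uncurry_left (f := fun (w' : Config (N + 1) (Fin 3) T3) x => empiricalMomentumField w' (boxKernel l x))
      (LGFS.measurable_empiricalMomentumField_param (n := N + 1) (k := boxKernel l) (LGFS.measurable_boxK_uncurry l))
  have hi := (EABirthS2bA.integrable_fields hl.le w).2.1
  refine (hi.norm.const_mul (max |a| |b| * G)).mono' (hZ.mul (hM.inner hΨ.measurable)).aestronglyMeasurable
    (Eventually.of_forall fun x => ?_)
  rw [Real.norm_eq_abs, abs_mul]
  have h1 : |statEntropy σ η₁ l a b w x| ≤ max |a| |b| :=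
    Literature.Analysis.FluidPDE.CompressibleEuler.abs_clamp_le hab _
  have h2 : |inner ℝ (empiricalMomentumField w (boxKernel l x)) (Ψ x)| ≤
      ‖empiricalMomentumField w (boxKernel l x)‖ * G :=
    (abs_real_inner_le_norm _ _).trans (mul_le_mul_of_nonneg_left ((le_abs_self _).trans (hG x)) (norm_nonneg _))
  calc |statEntropy σ η₁ l a b w x| * |inner ℝ (empiricalMomentumField w (boxKernel l x)) (Ψ x)|
      ≤ max |a| |b| * (‖empiricalMomentumField w (boxKernel l x)‖ * G) :=
        mul_le_mul h1 h2 (abs_nonneg _) (le_max_of_le_left (abs_nonneg a))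
    _ = max |a| |b| * G * ‖empiricalMomentumField w (boxKernel l x)‖ := by ring

/-- **Splitting of the bulk space integral**: `∫ statBulk dx = ∫ ρ̂ Z ψ₁(t,·) dx + ∫ Z m̂·ψ₂(t,·) dx` for continuous
slices `ψ₁(t,·)`, `ψ₂(t,·)` (`statBulk = statBdry(ψ₁ t) + Z m̂·ψ₂ t` definitionally; both summands integrable). -/
theorem integral_statBulk_split (hcont : ContinuousOn hsExcessFreeEnergy (Ico 0 η₀)) (hσ : 0 ≤ σ) (hη₁ : 0 ≤ η₁)
    (hη₁c : η₁ < η₀) (hab : a ≤ b) {l : ℝ} (hl : 0 < l) {ψ₁ : ℝ → T3 → ℝ} {ψ₂ : ℝ → T3 → V3} {t : ℝ}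
    (hψ₁ : Continuous (ψ₁ t)) (hψ₂ : Continuous (ψ₂ t)) (w : Config (N + 1) (Fin 3) T3) :
    ∫ x, statBulk σ η₁ l a b ψ₁ ψ₂ t w x = (∫ x, statBdry σ η₁ l a b (ψ₁ t) w x) +
      ∫ x, statEntropy σ η₁ l a b w x * inner ℝ (empiricalMomentumField w (boxKernel l x)) (ψ₂ t x) :=
  integral_add (integrable_statBdry hcont hσ hη₁ hη₁c hab hl hψ₁ w)
    (integrable_statEntropy_mul_inner hcont hσ hη₁ hη₁c hab hl hψ₂ w)

/-- **`N`-uniform affine bound on the bulk space integral**: if `‖ψ₁(t,·)‖ ≤ D` and `‖ψ₂(t,·)‖ ≤ Gs` then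
`|∫ statBulk dx| ≤ (M D + M Gs/2) + (M Gs/2) (N+1)⁻¹Σ‖vᵢ‖²`, `M = |a| ∨ |b|` (`|ρ̂ Z ψ₁ + Z m̂·ψ₂| ≤ M D ρ̂ + M Gs ‖m̂‖`,
`∫ ρ̂ dx = 1`, `∫ ‖m̂‖ dx ≤ (N+1)⁻¹Σ‖vᵢ‖ ≤ ½ + ½(N+1)⁻¹Σ‖vᵢ‖²`). -/
theorem abs_integral_statBulk_le (hab : a ≤ b) {l : ℝ} (hl : 0 < l) (hl1 : l ≤ 1) {ψ₁ : ℝ → T3 → ℝ}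
    {ψ₂ : ℝ → T3 → V3} {t D Gs : ℝ} (hD : ∀ x, ‖ψ₁ t x‖ ≤ D) (hGs : ∀ x, ‖ψ₂ t x‖ ≤ Gs)
    (w : Config (N + 1) (Fin 3) T3) :
    |∫ x, statBulk σ η₁ l a b ψ₁ ψ₂ t w x| ≤ (max |a| |b| * D + max |a| |b| * Gs / 2) +
      max |a| |b| * Gs / 2 * (((N : ℝ) + 1)⁻¹ * ∑ i, ‖(w i).2‖ ^ 2) := by
  set M := max |a| |b| with hM
  have hM0 : 0 ≤ M := le_max_of_le_left (abs_nonneg a)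
  have hGs0 : 0 ≤ Gs := (norm_nonneg _).trans (hGs 0)
  have hi := EABirthS2bA.integrable_fields hl.le w
  have hpt : ∀ x, ‖statBulk σ η₁ l a b ψ₁ ψ₂ t w x‖ ≤ M * D * empiricalDensityField w (boxKernel l x) +
      M * Gs * ‖empiricalMomentumField w (boxKernel l x)‖ := fun x => by
    have hZ : |statEntropy σ η₁ l a b w x| ≤ M := Literature.Analysis.FluidPDE.CompressibleEuler.abs_clamp_le hab _
    have hρ : 0 ≤ empiricalDensityField w (boxKernel l x) := EABirthS2bA.density_nonneg hl.le w x
    rw [Real.norm_eq_abs]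
    refine (abs_add_le _ _).trans (add_le_add ?_ ?_)
    · rw [abs_mul, abs_mul, abs_of_nonneg hρ]
      calc empiricalDensityField w (boxKernel l x) * |statEntropy σ η₁ l a b w x| * |ψ₁ t x|
          ≤ empiricalDensityField w (boxKernel l x) * M * D :=
            mul_le_mul (mul_le_mul_of_nonneg_left hZ hρ) ((Real.norm_eq_abs _).symm.trans_le (hD x))
              (abs_nonneg _) (mul_nonneg hρ hM0)
        _ = M * D * empiricalDensityField w (boxKernel l x) := by ring
    · rw [abs_mul]
      calc |statEntropy σ η₁ l a b w x| * |inner ℝ (empiricalMomentumField w (boxKernel l x)) (ψ₂ t x)|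
          ≤ M * (‖empiricalMomentumField w (boxKernel l x)‖ * Gs) :=
            mul_le_mul hZ ((abs_real_inner_le_norm _ _).trans (mul_le_mul_of_nonneg_left (hGs x) (norm_nonneg _)))
              (abs_nonneg _) hM0
        _ = M * Gs * ‖empiricalMomentumField w (boxKernel l x)‖ := by ring
  have h1 : |∫ x, statBulk σ η₁ l a b ψ₁ ψ₂ t w x| ≤ ∫ x, (M * D * empiricalDensityField w (boxKernel l x) +
      M * Gs * ‖empiricalMomentumField w (boxKernel l x)‖) := by
    rw [← Real.norm_eq_abs]
    exact norm_integral_le_of_norm_le ((hi.1.const_mul _).add (hi.2.1.norm.const_mul _)) (Eventually.of_forall hpt)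
  rw [integral_add (hi.1.const_mul _) (hi.2.1.norm.const_mul _), integral_const_mul, integral_const_mul,
    EABirthS2bA.integral_density_eq_one hl hl1, mul_one] at h1
  have h2 := (EABirthS2bA.integral_norm_momentum_le hl hl1 w).trans (EABirthS2bA.meanNorm_le w)
  nlinarith [h2, mul_nonneg hM0 hGs0]

end Statics

/-! ## Global equilibrium: the static LLNs at flow-time `0` transfer to every flow-time -/

section Frame

variable {σ ca cθ : ℝ} {cu : V3} {Φ : FlowFamily σ} {ℓ : ℕ → ℝ} {η₀ η₁ a b : ℝ}

/-- **The bulk at fixed time (global equilibrium).** For CONSTANT profiles, if at flow-time `0` the two entropy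
functionals `∫ ρ̂ Z ψ₁(t,·) dx` and `∫ Z m̂·ψ₂(t,·) dx` converge in `L¹(P_N)` to the constants `c₁`, `c₂` (the conclusion
of GE1 at the slices `ψ₁(t,·)`, `ψ₂(t,·)`), then the bulk space integral `∫ statBulk(t)(Ψ_t z, x) dx` along the
regularised flow `Ψ = gflow` converges in `L¹(P_N)` to `c₁ + c₂` (`P_N` is invariant under `Φ_t`:
`map_flow_localGibbsLaw_const`). -/
theorem tendsto_bulk (hcont : ContinuousOn hsExcessFreeEnergy (Ico 0 η₀)) (hσ : 0 < σ) (hη₁ : 0 < η₁) (hη₁c : η₁ < η₀)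
    (hab : a < b) (hℓ : ∀ N, 0 < ℓ N ∧ ℓ N ≤ 1)
    (hgood : ∀ N, localGibbsLaw σ (fun _ => ca) (fun _ => cu) (fun _ => cθ) N (Φ N) (Φ N).goodᶜ = 0)
    {ψ₁ : ℝ → T3 → ℝ} {ψ₂ : ℝ → T3 → V3} (t : ℝ) (hψ₁ : Continuous (ψ₁ t)) (hψ₂ : Continuous (ψ₂ t)) {c₁ c₂ : ℝ}
    (h₁ : Tendsto (fun N : ℕ => ∫⁻ z, ENNReal.ofReal
        |(∫ x, boxDensity σ ℓ Φ N 0 z x * boxClampedEntropy σ η₁ ℓ Φ a b N 0 z x * ψ₁ t x) - c₁|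
      ∂(localGibbsLaw σ (fun _ => ca) (fun _ => cu) (fun _ => cθ) N (Φ N))) atTop (𝓝 0))
    (h₂ : Tendsto (fun N : ℕ => ∫⁻ z, ENNReal.ofReal
        |(∫ x, boxClampedEntropy σ η₁ ℓ Φ a b N 0 z x * inner ℝ (boxMomentum σ ℓ Φ N 0 z x) (ψ₂ t x)) - c₂|
      ∂(localGibbsLaw σ (fun _ => ca) (fun _ => cu) (fun _ => cθ) N (Φ N))) atTop (𝓝 0)) :
    Tendsto (fun N : ℕ => ∫⁻ z, ENNReal.ofReal
        |(∫ x, statBulk σ η₁ (ℓ N) a b ψ₁ ψ₂ t (gflow (Φ N) t z) x) - (c₁ + c₂)|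
      ∂(localGibbsLaw σ (fun _ => ca) (fun _ => cu) (fun _ => cθ) N (Φ N))) atTop (𝓝 0) := by
  have hG := fun N => EABirthS1a.measurable_statEntropy (N := N) hcont hσ.le hη₁.le hη₁c (hℓ N).1.le a b
  -- the static functional `w ↦ ∫ statBulk(t)(w, x) dx` and its first summand are measurable in `w`
  have hFm : ∀ N, Measurable fun w : Config (N + 1) (Fin 3) T3 => ∫ x, statBulk σ η₁ (ℓ N) a b ψ₁ ψ₂ t w x :=
    fun N => by
      have h3 := EABirthS1a.measurable_statBulk (ψ₁ := fun _ => ψ₁ t) (ψ₂ := fun _ => ψ₂ t) (hG N)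
        (hψ₁.measurable.comp measurable_snd) (hψ₂.measurable.comp measurable_snd)
      exact ((h3.comp (((measurable_const (a := t)).prodMk measurable_fst).prodMk
        measurable_snd)).stronglyMeasurable.integral_prod_right').measurable
  have hF1m : ∀ N, Measurable fun w : Config (N + 1) (Fin 3) T3 => ∫ x, statBdry σ η₁ (ℓ N) a b (ψ₁ t) w x :=
    fun N => ((EABirthS1a.measurable_statBdry (hG N) hψ₁.measurable).stronglyMeasurable.integral_prod_right').measurable
  -- at flow-time `0`: the sum of the two functionals
  have hsum := h₁.add h₂
  rw [add_zero] at hsum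
  have h0 : Tendsto (fun N : ℕ => ∫⁻ z, ENNReal.ofReal
      |(∫ x, statBulk σ η₁ (ℓ N) a b ψ₁ ψ₂ t ((Φ N).flow 0 z) x) - (c₁ + c₂)|
      ∂(localGibbsLaw σ (fun _ => ca) (fun _ => cu) (fun _ => cθ) N (Φ N))) atTop (𝓝 0) := by
    refine tendsto_of_tendsto_of_tendsto_of_le_of_le' tendsto_const_nhds hsum
      (Eventually.of_forall fun N => bot_le) (Eventually.of_forall fun N => ?_)
    have hmeas : AEMeasurable (fun z => ENNReal.ofReal
        |(∫ x, boxDensity σ ℓ Φ N 0 z x * boxClampedEntropy σ η₁ ℓ Φ a b N 0 z x * ψ₁ t x) - c₁|)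
        (localGibbsLaw σ (fun _ => ca) (fun _ => cu) (fun _ => cθ) N (Φ N)) :=
      (continuous_abs.measurable.comp (((hF1m N).comp ((Φ N).measurable_flow 0)).sub
        measurable_const)).ennreal_ofReal.aemeasurable
    calc (∫⁻ z, ENNReal.ofReal |(∫ x, statBulk σ η₁ (ℓ N) a b ψ₁ ψ₂ t ((Φ N).flow 0 z) x) - (c₁ + c₂)|
          ∂(localGibbsLaw σ (fun _ => ca) (fun _ => cu) (fun _ => cθ) N (Φ N)))
        ≤ ∫⁻ z, (ENNReal.ofReal
            |(∫ x, boxDensity σ ℓ Φ N 0 z x * boxClampedEntropy σ η₁ ℓ Φ a b N 0 z x * ψ₁ t x) - c₁| +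
          ENNReal.ofReal |(∫ x, boxClampedEntropy σ η₁ ℓ Φ a b N 0 z x *
            inner ℝ (boxMomentum σ ℓ Φ N 0 z x) (ψ₂ t x)) - c₂|)
          ∂(localGibbsLaw σ (fun _ => ca) (fun _ => cu) (fun _ => cθ) N (Φ N)) := lintegral_mono fun z => by
          rw [integral_statBulk_split hcont hσ.le hη₁.le hη₁c hab.le (hℓ N).1 hψ₁ hψ₂,
            ← ENNReal.ofReal_add (abs_nonneg _) (abs_nonneg _), add_sub_add_comm]
          exact ENNReal.ofReal_le_ofReal (abs_add_le _ _)
      _ = _ := lintegral_add_left' hmeas _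
  -- transfer to flow-time `t` along the regularised flow
  refine h0.congr fun N => ?_
  exact (lintegral_abs_sub_gflow_eq (Φ N) (hgood N) (map_flow_localGibbsLaw_const σ ca cθ cu N (Φ N) t)
    (hFm N) (c₁ + c₂)).symm

/-- **The boundary term (global equilibrium).** For CONSTANT profiles, if at flow-time `0` the functional
`∫ ρ̂ Z χ dx` converges in `L¹(P_N)` to `c` (GE1 at the slice `χ`), then so does `∫ statBdry(χ)(Ψ_t z, x) dx` along
the regularised flow, at every flow-time `t`. -/
theorem tendsto_bdry (hcont : ContinuousOn hsExcessFreeEnergy (Ico 0 η₀)) (hσ : 0 < σ) (hη₁ : 0 < η₁) (hη₁c : η₁ < η₀)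
    (hℓ : ∀ N, 0 < ℓ N ∧ ℓ N ≤ 1)
    (hgood : ∀ N, localGibbsLaw σ (fun _ => ca) (fun _ => cu) (fun _ => cθ) N (Φ N) (Φ N).goodᶜ = 0)
    {χ : T3 → ℝ} (hχ : Continuous χ) (t : ℝ) {c : ℝ}
    (h : Tendsto (fun N : ℕ => ∫⁻ z, ENNReal.ofReal
        |(∫ x, boxDensity σ ℓ Φ N 0 z x * boxClampedEntropy σ η₁ ℓ Φ a b N 0 z x * χ x) - c|
      ∂(localGibbsLaw σ (fun _ => ca) (fun _ => cu) (fun _ => cθ) N (Φ N))) atTop (𝓝 0)) :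
    Tendsto (fun N : ℕ => ∫⁻ z, ENNReal.ofReal |(∫ x, statBdry σ η₁ (ℓ N) a b χ (gflow (Φ N) t z) x) - c|
      ∂(localGibbsLaw σ (fun _ => ca) (fun _ => cu) (fun _ => cθ) N (Φ N))) atTop (𝓝 0) := by
  have hFm : ∀ N, Measurable fun w : Config (N + 1) (Fin 3) T3 => ∫ x, statBdry σ η₁ (ℓ N) a b χ w x := fun N =>
    ((EABirthS1a.measurable_statBdry (EABirthS1a.measurable_statEntropy (N := N) hcont hσ.le hη₁.le hη₁c
      (hℓ N).1.le a b) hχ.measurable).stronglyMeasurable.integral_prod_right').measurable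
  refine h.congr fun N => ?_
  exact (lintegral_abs_sub_gflow_eq (Φ N) (hgood N) (map_flow_localGibbsLaw_const σ ca cθ cu N (Φ N) t)
    (hFm N) c).symm

end Frame

/-! ## The registered helper stub -/

/-- Signature of the registered helper stub `stub_globalEquilibriumEntropyBalanceA` (file A of GE3): (1) along a law
carried by the good set of a hard-sphere flow and invariant under `Φ_t`, the `L¹` distance of a measurable static
functional to a constant is the same at flow-time `t` (regularised flow) as at flow-time `0`; (2) the `N`-uniform affine
bound on the bulk space integral of the clamp-renormalised entropy balance. -/
def Sig.stub_globalEquilibriumEntropyBalanceA : Prop :=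
  (∀ (n : ℕ) (ε : ℝ) (Φ : HardSphereFlow (Literature.Analysis.FluidPDE.Torus.geometry (Fin 3)) ε n)
      (μ : Measure (Config n (Fin 3) T3)), μ Φ.goodᶜ = 0 → ∀ t : ℝ, μ.map (Φ.flow t) = μ →
      ∀ F : Config n (Fin 3) T3 → ℝ, Measurable F → ∀ c : ℝ,
        ∫⁻ z, ENNReal.ofReal |F (gflow Φ t z) - c| ∂μ = ∫⁻ z, ENNReal.ofReal |F (Φ.flow 0 z) - c| ∂μ) ∧
    ∀ (N : ℕ) (σ η₁ a b : ℝ), a ≤ b → ∀ l : ℝ, 0 < l → l ≤ 1 →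
      ∀ (ψ₁ : ℝ → T3 → ℝ) (ψ₂ : ℝ → T3 → V3) (t D Gs : ℝ), (∀ x, ‖ψ₁ t x‖ ≤ D) → (∀ x, ‖ψ₂ t x‖ ≤ Gs) →
        ∀ w : Config (N + 1) (Fin 3) T3,
          |∫ x, statBulk σ η₁ l a b ψ₁ ψ₂ t w x| ≤ (max |a| |b| * D + max |a| |b| * Gs / 2) +
            max |a| |b| * Gs / 2 * (((N : ℝ) + 1)⁻¹ * ∑ i, ‖(w i).2‖ ^ 2)

/-- **Registered helper stub `stub_globalEquilibriumEntropyBalanceA`** (crux stmt-AtomisticToContinuum-9903, line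
`registered`; toolbox of GE3): the invariance transfer of `L¹` distances along the regularised flow and the
`N`-uniform bulk bound. -/
theorem stub_globalEquilibriumEntropyBalanceA : Sig.stub_globalEquilibriumEntropyBalanceA :=
  ⟨fun _ _ Φ _ hgood _ hinv _ hF c => lintegral_abs_sub_gflow_eq Φ hgood hinv hF c,
    fun _ _ _ _ _ hab _ hl hl1 _ _ _ _ _ hD hGs w => abs_integral_statBulk_le hab hl hl1 hD hGs w⟩

end Summit.AtomisticToContinuum.HydrodynamicLimit.Theorems.EABirthGE3

end
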